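import Literature.NumberTheory.EllipticCurves.HeegnerPointsKolyvaginPrimaryCebotarevKernelProofs
import Literature.NumberTheory.EllipticCurves.HeegnerPointsKolyvaginPrimaryDescentProofs
import HarnessLib

/-!
# The Čebotarev input `hCeb` of Kolyvagin's order bound, for concrete descent data

Sibling proof file of `HeegnerPointsKolyvaginPrimaryCebotarevKernelProofs` (McCallum 1991,
Prop. 3.1 in kernel form for `H¹(K, E[p^M])`) and of
`HeegnerPointsKolyvaginPrimaryOrderTelescopeProofs` (Kolyvagin's `∑ Nᵢ ≤ M₀`, hypothesis `hCeb`).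
For any descent data `S : KolyvaginDescent.HypothesesM (H¹(K, E[p^M])) Pl` whose involution is
`c_*`, whose Kolyvagin primes contain the level-`p^M` Kolyvagin primes
(`IsKolyvaginPrime N W K p ℓ ∧ FrobEqFrobInfty W K (p^M) ℓ`) and whose strict local conditions
`A ℓ` at those primes are "`c_v = 0` at every place `v ∋ ℓ`" — the dictionary of
`KolyvaginDescent.exists_hypothesesM_of_leavesM` — the hypothesis `hCeb` holds:

* `KolyvaginDescent.HypothesesM.ceb_kernel_of_dictionary`.

No named fact is introduced; inputs: the Čebotarev density theorem and the Weil pairing (through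
`McCallum1991_prop_3_1_kernel_of_chebotarev`).

## References

* W. G. McCallum, *Kolyvagin's work on Shafarevich–Tate groups*, LMS Lecture Note Ser. 153
  (1991), 295–316, §3 Prop. 3.1, (3). [McCallumLMS1991]
-/

noncomputable section

open scoped Classical
open WeierstrassCurve NumberField IsDedekindDomain Field
open Literature.NumberTheory.GaloisRepresentations

universe u

namespace Literature.NumberTheory.EllipticCurves

namespace KolyvaginDescent

namespace HypothesesM

variable {W : WeierstrassCurve ℚ} {K : Type u} [Field K] [NumberField K]

/-- **`hCeb` for concrete descent data** (McCallum 1991, Prop. 3.1 in kernel form, through the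
dictionary `τ = c_*`, `Kol ⊇ {ℓ : IsKolyvaginPrime ∧ FrobEqFrobInfty}`, `A ℓ = ⋂_{v ∋ ℓ} ker loc_v`):
for eigenclasses `g₁ ∈ V^{ν}`, `g₂ ∈ V^{-ν}` and a finite set `T` of eigenclasses there is, above
every bound, a Kolyvagin prime `ℓ` of `S` with `⟨g₁, g₂, T⟩ ∩ A ℓ = ⟨T⟩`.
[cite: McCallumLMS1991, §3 Prop. 3.1 with (2), (3)] -/
theorem ceb_kernel_of_dictionary {Pl : Type*} {N : ℕ} [NeZero N] [W.IsElliptic] {p M : ℕ}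
    (S : HypothesesM (galH1Torsion (W.baseChange K) ((p ^ M : ℕ) : ℤ)) Pl)
    (hC : Automorphic.chebotarev_artinRep) (hK : IsImaginaryQuadratic K) (hp : p.Prime)
    (hp2 : p ≠ 2) (hρ : W.HasSurjectiveModNGaloisRep p) (hW : W.exists_weilPairing p)
    (hM : 1 ≤ M) {c : K ≃ₐ[ℚ] K} (hc : c ≠ 1) (hcc : c * c = 1)
    (hτ : ∀ g, S.τ g = conjAct W c ((p ^ M : ℕ) : ℤ) g)
    (hKol : ∀ ℓ, IsKolyvaginPrime N W K p ℓ → FrobEqFrobInfty W K (p ^ M) ℓ → S.Kol ℓ)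
    (hA : ∀ ℓ, IsKolyvaginPrime N W K p ℓ → ∀ g, g ∈ S.A ℓ ↔
      ∀ v : HeightOneSpectrum (𝓞 K), (ℓ : 𝓞 K) ∈ v.asIdeal →
        g ∈ (W.baseChange K).torsionLocalKer (v.adicCompletion K) ((p ^ M : ℕ) : ℤ))
    (T : Finset (galH1Torsion (W.baseChange K) ((p ^ M : ℕ) : ℤ)))
    (g₁ g₂ : galH1Torsion (W.baseChange K) ((p ^ M : ℕ) : ℤ)) (ν : ℤ) (hν : ν = 1 ∨ ν = -1)
    (hg₁ : S.τ g₁ = ν • g₁) (hg₂ : S.τ g₂ = (-ν) • g₂)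
    (hT : ∀ t ∈ T, ∃ e : ℤ, (e = 1 ∨ e = -1) ∧ S.τ t = e • t) (b : ℕ) :
    ∃ ℓ, b < ℓ ∧ S.Kol ℓ ∧ ∀ g ∈ AddSubgroup.closure (insert g₁ (insert g₂ (T : Set _))),
      g ∈ S.A ℓ ↔ g ∈ AddSubgroup.closure (T : Set _) := by
  rw [hτ] at hg₁ hg₂
  have hT' : ∀ t ∈ T, ∃ e : ℤ, (e = 1 ∨ e = -1) ∧ conjAct W c ((p ^ M : ℕ) : ℤ) t = e • t :=
    fun t ht ↦ by obtain ⟨e, he, h⟩ := hT t ht; exact ⟨e, he, hτ t ▸ h⟩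
  obtain ⟨ℓ, hbℓ, hKP, hfrob, hloc⟩ := McCallum1991_prop_3_1_kernel_of_chebotarev (N := N) hC hK
    hp hp2 hρ hW hM hc hcc T g₁ g₂ hν hg₁ hg₂ hT' b
  refine ⟨ℓ, hbℓ, hKol ℓ hKP hfrob, fun g hg ↦ ?_⟩
  rw [hA ℓ hKP g]
  constructor
  · intro h
    exact (hloc g hg hKP.place hKP.mem_place).mp (h hKP.place hKP.mem_place)
  · intro h v hv
    exact (hloc g hg v hv).mpr h

/-- **`hCeb` at a level written `n = p^M`** — the statement of `ceb_kernel_of_dictionary` with the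
torsion level and the level of the Kolyvagin primes written as a natural number `n` with `n = p^M`
supplied as a hypothesis (for consumers at a level presented as `m · m`; proof: `subst`).
[cite: McCallumLMS1991, §3 Prop. 3.1, (2), (3)] -/
theorem ceb_kernel_of_dictionary_level {Pl : Type*} {N : ℕ} [NeZero N] [W.IsElliptic] {p M n : ℕ}
    (hn : n = p ^ M)
    (S : HypothesesM (galH1Torsion (W.baseChange K) (n : ℤ)) Pl)
    (hC : Automorphic.chebotarev_artinRep) (hK : IsImaginaryQuadratic K) (hp : p.Prime)
    (hp2 : p ≠ 2) (hρ : W.HasSurjectiveModNGaloisRep p) (hW : W.exists_weilPairing p)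
    (hM : 1 ≤ M) {c : K ≃ₐ[ℚ] K} (hc : c ≠ 1) (hcc : c * c = 1)
    (hτ : ∀ g, S.τ g = conjAct W c (n : ℤ) g)
    (hKol : ∀ ℓ, IsKolyvaginPrime N W K p ℓ → FrobEqFrobInfty W K n ℓ → S.Kol ℓ)
    (hA : ∀ ℓ, IsKolyvaginPrime N W K p ℓ → ∀ g, g ∈ S.A ℓ ↔
      ∀ v : HeightOneSpectrum (𝓞 K), (ℓ : 𝓞 K) ∈ v.asIdeal →
        g ∈ (W.baseChange K).torsionLocalKer (v.adicCompletion K) (n : ℤ))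
    (T : Finset (galH1Torsion (W.baseChange K) (n : ℤ)))
    (g₁ g₂ : galH1Torsion (W.baseChange K) (n : ℤ)) (ν : ℤ) (hν : ν = 1 ∨ ν = -1)
    (hg₁ : S.τ g₁ = ν • g₁) (hg₂ : S.τ g₂ = (-ν) • g₂)
    (hT : ∀ t ∈ T, ∃ e : ℤ, (e = 1 ∨ e = -1) ∧ S.τ t = e • t) (b : ℕ) :
    ∃ ℓ, b < ℓ ∧ S.Kol ℓ ∧ ∀ g ∈ AddSubgroup.closure (insert g₁ (insert g₂ (T : Set _))),
      g ∈ S.A ℓ ↔ g ∈ AddSubgroup.closure (T : Set _) := by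
  subst hn
  exact S.ceb_kernel_of_dictionary hC hK hp hp2 hρ hW hM hc hcc hτ hKol hA T g₁ g₂ ν hν hg₁ hg₂ hT b

end HypothesesM

end KolyvaginDescent

end Literature.NumberTheory.EllipticCurves

end
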